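import Summits.ResolutionOfSingularities.ResolutionOfSingularities.Theorems.HilbertSamuelEliminationSigmaMaxModificationsCorridor3MaxOrderRestriction
import Summits.ResolutionOfSingularities.ResolutionOfSingularities.Theorems.HilbertSamuelEliminationSigmaMaxModificationsCorridor3ChartOrderDictionary
import Summits.ResolutionOfSingularities.ResolutionOfSingularities.Theorems.HilbertSamuelEliminationSigmaMaxModificationsCorridor3RegularCentresPermissible
import Literature.AlgebraicGeometry.Resolution.KollarPushforward
import Literature.AlgebraicGeometry.Resolution.RegularBlowup
import Literature.AlgebraicGeometry.Resolution.ExcellentRingsFieldProofs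
import HarnessLib

/-!
# Route `HilbertSamuelElimination`, crux `SigmaMaxModificationsCorridor3`
# (stmt-ResolutionOfSingularities-19249; child of `SigmaMaxModifications` stmt-…-18506),
# line `tame_wild` v3 — brick **T1: the per-chart transfer** (`stub_T1_chartTransfer`)

[OURS · L1 W4.2] Brick T1 of the lead's helper programme v3 — hypothesis `hT1` of the landed
`confinedTameNu3_of_thor4_of_T123` (p483233), in the RATIFIED form T1′ (CHAIN w42 v3.2 §0b: `hT1` plus
the two antecedents `[IsLocallyNoetherian Z]` and `ν ≠ Φ^{(3)}`, both held at the call site; the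
original omits them — `Scheme.IsRegular` is stalkwise, and for `ν = Φ^{(3)}` the centre is the whole
chart). Given a hypersurface chart `ι : V ↪ Z` of an open `V ⊆ Y` (`Y` reduced, locally of finite
type over a field `k`, `dim Y ≤ 3`; `Z` regular, locally Noetherian; `ker ι = I` effective Cartier),
the dictionary `supp(Z, I, ∅, m) = ι(V(ν))`, `ord I ≤ m`, a maximal value `ν ≠ Φ^{(3)}` of `Σ_Y(3)`, and
a data-level resolution `t : CentreSeq Z` of the marked ideal `(Z, I, ∅, m)` (BGMW Def. 3.1.3), the
INDUCED SEQUENCE `s := t.comap ι` on `V` (Kollár 2007, 3.30.2 "restriction of a blow-up sequence to a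
closed subscheme": centres `Z_i ∩ S_i`, natural embeddings `S_i ↪ X_i`; tree `CentreSeq.comap`,
`blowup.comapMap`) has regular centres inside the successive `ν`-strata and kills `ν`; by the
landed clauses of res-L1-w42-stub-3 (p478970: regular centres inside a Hilbert–Samuel stratum of a
reduced excellent scheme are permissible, `H` is non-increasing by CJS Thm. 3.10 (1), the centres lie
over `V(ν)`) this is the conclusion of the brick. NOT a statement of any manuscript.

* `comap_clauses_of_isResolutionOf` — THE RECURSION along `t` with the invariant "`Z` regular and
  locally Noetherian, `ker ι` a hypersurface (principal stalks) of order `≤ m`, `dim 𝒪_{V,v} ≤ 3`":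
  at each stage the centre `C ⊆ supp = ι(V(ν))` (dictionary from the order bound,
  `…Corridor3ChartOrderDictionary`) has order exactly `m`, lies scheme-theoretically on `V`
  (`ker ι ≤ C`), so `C|_V` is regular with support in `V(ν)`; the next embedding
  `Bl_{C|_V} V ↪ Bl_C Z` has kernel the weak transform `(π^*I : 𝓘(D)^m)` (restriction property at
  maximal order, `ker_comapMap_of_maxOrder`, `…Corridor3MaxOrderRestriction`), again a hypersurface
  (Kollár 3.60) of order `≤ m` (CoP1 Prop. 4.2 (a)); empty final support kills `ν`;
* `stub_T1_chartTransfer` — **brick T1′**.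

## Sources

* J. Kollár, *Lectures on Resolution of Singularities* (2007), Def. 3.30 (3.30.2), 3.58–3.60. [Kollar2007]
* V. Cossart, U. Jannsen, S. Saito, LNM 2270 (2020), Thm. 2.3, Def. 2.28, Thm. 3.3, Thm. 3.10 (1), Def. 6.14. [CossartJannsenSaito2020]
* E. Bierstone, D. Grigoriev, P. Milman, J. Włodarczyk, arXiv:1206.3090, Def. 3.1.2–3.1.4, §4 Remark (3). [BierstoneGrigorievMilmanWlodarczyk2011]
* V. Cossart, O. Piltant, J. Algebra 320 (2008), proof of Prop. 4.2 (a). [CossartPiltant2008]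
-/

set_option linter.dupNamespace false -- mandated namespace of this single-conjunct summit

noncomputable section

open CategoryTheory AlgebraicGeometry TopologicalSpace Topology IsLocalRing
open Literature.AlgebraicGeometry.Resolution Literature.RingTheory.HilbertSamuel Scheme.IdealSheafData
open Summit.ResolutionOfSingularities.ResolutionOfSingularities.Theorems.SigmaMaxModificationsCorridor3.TameWild

namespace Summit.ResolutionOfSingularities.ResolutionOfSingularities.Theorems.SigmaMaxModificationsCorridor3.Helpers

/-! ## The recursion along the resolution of the marked ideal -/

/-- **The induced sequence of a resolution of `(Z, ker ι, E, m)` on the hypersurface chart: regular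
centres in the `ν`-strata, `ν` killed** (`ν = hypersurfaceHF m`). Invariant along `t`: `Z` regular,
locally Noetherian; `ker ι` with principal stalks of order `≤ m`; `dim 𝒪_{V,v} ≤ 3`. Step: the centre
`C` is regular (admissibility), contained in `supp = ι(V(ν))` (dictionary from the order bound), hence
of order exactly `m` and scheme-theoretically on `V` (`ker ι ≤ C`, `C` being radical), so `C|_V` is
regular (`V(C|_V) ≅ V(C)`) with support in `V(ν)`; along `Bl_{C|_V} V ↪ Bl_C Z` (Kollár 3.30.2) the
kernel is the weak transform `(π^*I : 𝓘(D)^m)` (restriction property at maximal order), again with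
principal stalks (Kollár 3.60) of order `≤ m` (CoP1 4.2 (a)), the blown-up ambient is regular and the
local dimensions do not grow (Matsumura 15.5); at the end `supp = ∅` kills `ν`.
[cite: Kollar2007, 3.30.2, 3.58–3.60] [cite: CossartPiltant2008, proof of Prop. 4.2 (a)]
[cite: BierstoneGrigorievMilmanWlodarczyk2011, Def. 3.1.3] -/
theorem comap_clauses_of_isResolutionOf {Z : Scheme.{0}} (t : CentreSeq Z) :
    ∀ [IsLocallyNoetherian Z] {V : Scheme.{0}} [IsLocallyNoetherian V] (ι : V ⟶ Z)
      [IsClosedImmersion ι] (E : List Z.IdealSheafData) (m : ℕ), Scheme.IsRegular Z → 1 ≤ m →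
      (∀ z, (stalkIdeal ι.ker z).IsPrincipal) → (∀ z, idealOrder ι.ker z ≤ (m : ℕ∞)) →
      (∀ v : V, ringKrullDim (V.presheaf.stalk v) ≤ ((3 : ℕ) : WithBot ℕ∞)) →
      t.IsResolutionOf (⟨ι.ker, E, m⟩ : MarkedIdeal Z) →
      (t.comap ι).AllRegular ∧ (t.comap ι).CentresInStratum 3 (hypersurfaceHF m) ∧
        hypersurfaceHF m ∉ Scheme.hsValues (t.comap ι).top 3 := by
  induction t with
  | nil Z =>
    intro _ V _ ι _ E m hZ hm hI hord hdim ht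
    refine ⟨CentreSeq.allRegular_nil V, CentreSeq.centresInStratum_nil V, ?_⟩
    rw [CentreSeq.comap_nil, CentreSeq.top_nil]
    exact not_mem_hsValues_of_support_eq_empty ι hZ hI hm hord hdim
      ((CentreSeq.isResolutionOf_nil_iff _).mp ht)
  | cons C rest ih =>
    intro _ V _ ι _ E m hZ hm hI hord hdim ht
    obtain ⟨hCsupp, -, hC, hadm⟩ := (CentreSeq.isAdmissibleFor_cons C rest _).mp ht.1
    have htop : (rest.transformMarked
        (MarkedIdeal.transform (blowup.π C) C (⟨ι.ker, E, m⟩ : MarkedIdeal _))).support = ∅ := by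
      have h := ht.2
      rwa [CentreSeq.transformMarked_cons] at h
    -- the centre: order exactly `m`, scheme-theoretically on `V`, regular on `V`, inside `V(ν)`
    have hsuppM : (⟨ι.ker, E, m⟩ : MarkedIdeal _).support =
        ι.base '' Scheme.hsStratum V 3 (hypersurfaceHF m) :=
      support_eq_image_hsStratum_of_forall_idealOrder_le ι hZ hI hm hord hdim E
    have hμ : ∀ y ∈ (C.support : Set _), idealOrder ι.ker y = m := fun y hy =>
      le_antisymm (hord y) (hCsupp hy)
    have hkerC : ι.ker ≤ C := by
      have h1 : C.support ≤ ι.ker.support := by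
        intro z hz
        have hz' : z ∈ (⟨ι.ker, E, m⟩ : MarkedIdeal _).support := hCsupp hz
        rw [hsuppM] at hz'
        obtain ⟨v, -, rfl⟩ := hz'
        exact apply_mem_support_ker ι v
      exact (Scheme.IdealSheafData.le_support_iff_le_vanishingIdeal.mp h1).trans_eq
        (eq_vanishingIdeal_support_of_isRegular C hC).symm
    have hD : Scheme.IsRegular (C.comap ι).subscheme := by
      have h := isRegular_subscheme_map_iff_of_isClosedImmersion ι (C.comap ι)
      rw [map_comap_of_ker_le C ι hkerC] at h
      exact h.mp hC
    have hDstr : ((C.comap ι).support : Set V) ⊆ Scheme.hsStratum V 3 (hypersurfaceHF m) :=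
      support_comap_subset_hsStratum ι hZ hI hm hord hdim hCsupp
    -- the next stage
    haveI : IsProper (blowup.π C) := (blowup.isBlowup C).isProper
    haveI : IsLocallyNoetherian (blowup C) := LocallyOfFiniteType.isLocallyNoetherian (blowup.π C)
    haveI : IsProper (blowup.π (C.comap ι)) := (blowup.isBlowup (C.comap ι)).isProper
    haveI : IsLocallyNoetherian (blowup (C.comap ι)) :=
      LocallyOfFiniteType.isLocallyNoetherian (blowup.π (C.comap ι))
    have hZ₁ : Scheme.IsRegular (blowup C) :=
      IsBlowup.isRegular_of_isRegular_subscheme hZ hC (blowup.isBlowup C)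
    have hker₁ : (blowup.comapMap C ι).ker = controlledTransform (blowup.π C) C ι.ker m :=
      ker_comapMap_of_maxOrder ι hZ C hC hμ hI
    have hCY : C = vanishingIdeal C.support := eq_vanishingIdeal_support_of_isRegular C hC
    have hπ' : IsBlowup (blowup.π C) (vanishingIdeal C.support) := by
      rw [← hCY]; exact blowup.isBlowup C
    have hreg' : Scheme.IsRegular (vanishingIdeal C.support).subscheme := by rw [← hCY]; exact hC
    have hI₁ : ∀ z', (stalkIdeal (blowup.comapMap C ι).ker z').IsPrincipal := by
      intro z'
      rw [hker₁]
      have h := IsBlowup.isPrincipal_stalkIdeal_controlledTransform hZ hreg' hπ' hμ hI z'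
      rwa [← hCY] at h
    have hord₁ : ∀ z', idealOrder (blowup.comapMap C ι).ker z' ≤ (m : ℕ∞) := by
      intro z'
      rw [hker₁]
      have h := IsBlowup.idealOrder_controlledTransform_le_of_forall hZ hreg' hπ' hμ hord z'
      rwa [← hCY] at h
    have hdim₁ : ∀ v₁ : ↥(blowup (C.comap ι)),
        ringKrullDim ((blowup (C.comap ι)).presheaf.stalk v₁) ≤ ((3 : ℕ) : WithBot ℕ∞) := fun v₁ =>
      ((blowup.isBlowup (C.comap ι)).ringKrullDim_stalk_le_of_isLocallyNoetherian v₁).trans (hdim _)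
    -- the transformed marked ideal is `(Bl_C Z, ker ι₁, E₁, m)`
    have hrest : rest.IsResolutionOf (⟨(blowup.comapMap C ι).ker,
        (MarkedIdeal.transform (blowup.π C) C (⟨ι.ker, E, m⟩ : MarkedIdeal _)).boundary, m⟩ :
          MarkedIdeal (blowup C)) := by
      rw [hker₁]
      exact ⟨hadm, htop⟩
    -- induction
    obtain ⟨hreg₁, hstr₁, hkill₁⟩ := ih (blowup.comapMap C ι) _ m hZ₁ hm hI₁ hord₁ hdim₁ hrest
    refine ⟨?_, ?_, ?_⟩
    · rw [CentreSeq.comap_cons, CentreSeq.allRegular_cons]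
      exact ⟨hD, hreg₁⟩
    · rw [CentreSeq.comap_cons, CentreSeq.centresInStratum_cons]
      exact ⟨hDstr, hstr₁⟩
    · rw [CentreSeq.comap_cons, CentreSeq.top_cons]
      exact hkill₁

/-! ## Brick T1′ -/

/-- **Brick T1′ — the per-chart transfer** (`hT1` of `confinedTameNu3_of_thor4_of_T123` with the two
ratified antecedents `[IsLocallyNoetherian Z]`, `ν ≠ Φ^{(3)}`; CHAIN w42 v3.2). A data-level resolution
`t` of the marked ideal `(Z, I, ∅, m)` of a hypersurface chart `ι : V ↪ Z` (`Z` regular, `I = ker ι`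
effective Cartier, `supp = ι(V(ν))`, `ord I ≤ m`, `ν` maximal in `Σ_Y(3)` for the ambient `Y ⊇ V`
reduced of finite type over a field with `dim Y ≤ 3`) induces the blow-up sequence `s := t.comap ι`
of `V` (Kollár 3.30.2) with regular centres over `V(ν)`, `H³` non-increasing along `s.comp`, and
`ν ∉ Σ_{s.top}(3)`. If `ν ∉ Σ_V(3)` already, `s := ∅`. Otherwise `ν = hypersurfaceHF m` (a stratum
point of the chart has multiplicity `m`), `comap_clauses_of_isResolutionOf` gives regular centres in
the strata and the kill, and — `V` being reduced, excellent (finite type over a field) of dimension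
`≤ 3`, `ν ≠ Φ^{(3)}` maximal in `Σ_V(3)` — regular centres in the strata are permissible, lie over
`V(ν)` and make `H³` non-increasing (res-L1-w42-stub-3's
`CentreSeq.confinementClauses_of_allRegular_of_centresInStratum`, CJS Thm. 3.3 / Thm. 3.10 (1)).
[cite: Kollar2007, 3.30.2, 3.58–3.60] [cite: CossartJannsenSaito2020, Thm. 3.3, Thm. 3.10 (1), Def. 6.14]
[cite: BierstoneGrigorievMilmanWlodarczyk2011, Def. 3.1.3, §4 Remark (3)] -/
theorem stub_T1_chartTransfer (k : Type) [Field k] (Y : Scheme.{0}) (g : Y ⟶ Spec (.of k))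
    [LocallyOfFiniteType g] [IsReduced Y] (hY : topologicalKrullDim Y ≤ ((3 : ℕ) : WithBot ℕ∞))
    (ν : ℕ → ℕ) (hν : Maximal (· ∈ Scheme.hsValues Y 3) ν) (hνΦ : ν ≠ iterPSum 3 Phi)
    (m : ℕ) (hm : 1 ≤ m)
    (V : Scheme.{0}) (j : V ⟶ Y) [IsOpenImmersion j] (Z : Scheme.{0}) [IsLocallyNoetherian Z]
    (hZ : Scheme.IsRegular Z) (I : Z.IdealSheafData) (hI : IsEffectiveCartier I) (ι : V ⟶ Z)
    [IsClosedImmersion ι] (hιI : ι.ker = I)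
    (hsupp : (⟨I, [], m⟩ : MarkedIdeal Z).support = ι.base '' Scheme.hsStratum V 3 ν)
    (hord : ∀ z : Z, idealOrder I z ≤ (m : ℕ∞))
    (t : CentreSeq Z) (ht : t.IsResolutionOf (⟨I, [], m⟩ : MarkedIdeal Z)) :
    ∃ s : CentreSeq V, s.AllRegular ∧ s.CentresOver (Scheme.hsStratum V 3 ν) ∧
      (∀ x' : s.top, Scheme.hsFun s.top 3 x' ≤ Scheme.hsFun V 3 (s.comp.base x')) ∧
      ν ∉ Scheme.hsValues s.top 3 := by
  haveI : IsLocallyNoetherian Y := LocallyOfFiniteType.isLocallyNoetherian g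
  haveI : IsLocallyNoetherian V := isLocallyNoetherian_of_isOpenImmersion j
  haveI : IsReduced V := isReduced_of_isOpenImmersion j
  subst hιI
  by_cases hνV : ν ∈ Scheme.hsValues V 3
  swap
  · refine ⟨CentreSeq.nil V, CentreSeq.allRegular_nil V, CentreSeq.centresOver_nil V _,
      fun x' => ?_, hνV⟩
    show Scheme.hsFun V 3 x' ≤ Scheme.hsFun V 3 x'
    exact le_rfl
  -- principal stalks, local dimensions
  have hIp : ∀ z, (stalkIdeal ι.ker z).IsPrincipal := fun z => by
    obtain ⟨f, -, hf⟩ := hI.exists_stalkIdeal_eq_span z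
    rw [hf]
    exact ⟨⟨f, rfl⟩⟩
  have hdimV : topologicalKrullDim V ≤ ((3 : ℕ) : WithBot ℕ∞) :=
    (j.isOpenEmbedding.isInducing.topologicalKrullDim_le).trans hY
  have hdim : ∀ v : V, ringKrullDim (V.presheaf.stalk v) ≤ ((3 : ℕ) : WithBot ℕ∞) := fun v =>
    (ringKrullDim_stalk_le_topologicalKrullDim V v).trans hdimV
  -- `ν = hypersurfaceHF m`: a stratum point of the chart has multiplicity `m`
  obtain ⟨v₀, hv₀⟩ := hνV
  have hνm : ν = hypersurfaceHF m := by
    have h1 : ι.base v₀ ∈ (⟨ι.ker, [], m⟩ : MarkedIdeal Z).support := by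
      rw [hsupp]
      exact ⟨v₀, hv₀, rfl⟩
    rw [support_eq_image_hsStratum_of_forall_idealOrder_le ι hZ hIp hm hord hdim []] at h1
    obtain ⟨v₁, hv₁, he⟩ := h1
    rw [ι.isClosedEmbedding.injective he, Scheme.mem_hsStratum_iff] at hv₁
    exact hv₀.symm.trans hv₁
  subst hνm
  -- the induced sequence
  obtain ⟨hreg, hstr, hkill⟩ := comap_clauses_of_isResolutionOf t ι [] m hZ hm hIp hord hdim ht
  -- clauses: regular centres in the strata of the reduced excellent `V` are permissible, etc.
  have hexc : Scheme.IsExcellent V := Scheme.isExcellent_of_locallyOfFiniteType Stacks07QW_field_holds (j ≫ g)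
  have hmaxV : Maximal (· ∈ Scheme.hsValues V 3) (hypersurfaceHF m) :=
    ⟨⟨v₀, hv₀⟩, fun μ hμ hle => hν.2 (Scheme.hsValues_subset_of_isOpenImmersion j 3 hμ) hle⟩
  obtain ⟨-, hover, hmono⟩ := CentreSeq.confinementClauses_of_allRegular_of_centresInStratum
    (t.comap ι) hexc hdimV hνΦ hmaxV hreg hstr
  exact ⟨t.comap ι, hreg, hover, hmono, hkill⟩

end Summit.ResolutionOfSingularities.ResolutionOfSingularities.Theorems.SigmaMaxModificationsCorridor3.Helpers

end
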